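import Summits.QuantumFields.YangMills.Theorems.ColdStartUniversalityLatticeLangevinSU2ExpChart
import Summits.QuantumFields.YangMills.Theorems.ColdStartUniversalityLatticeLangevinGradientBoundCalculus
import Summits.QuantumFields.YangMills.Theorems.ColdStartUniversalityLatticeLangevinSU2Bracket
import Mathlib.Analysis.Calculus.MeanValue
import HarnessLib

/-!
# Route `ColdStartUniversality` (fixed-cut-off package, Bakry–Émery side, GRADIENT half): the OSCILLATION–CARRÉ DU CHAMP LEMMA on `SU(2)^E` —
# `|G(coords V') − G(coords V)| ≤ π·√#E·σ` whenever `Γ^A(G) ≤ σ²`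

Helper file (seat `ym-line-csu-p1`, g29; `--supports stmt-QuantumFields-24809`).  Turns the Lipschitz (carré du champ) bounds of the gradient-bound
package (`…LatticeLangevinBakryEmeryGradientBound`, `…LatticeLangevinGradientBoundOfRep`) into OSCILLATION bounds: move ALL links simultaneously along
one-parameter subgroups `s ↦ e^(sX_e)·V_e` with the norm-controlled logarithms `X_e` of `V'_e V_e⁻¹` (`exists_su2_generator_norm_le`, `⟨X_e,X_e⟩ ≤ 2π²`);
the velocity of `G∘coords` along this flow is `Σ_n c_n·W_nG` with `Σ_n c_n² = ½Σ_e ⟨X_e, X_e⟩ ≤ π²·#E` (Parseval along the noise frame), so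
Cauchy–Schwarz (`Σ_n (W_nG)² = Γ^A(G)`) and the mean value inequality give the bound — with `√#E`, not `#E`, which is what makes the sup-norm
bounds of the sequel VOLUME-FREE for volume-averaged observables.
* `frameField_decomposition` — the coordinate field of `δ_e(X·Q_e)`, `X ∈ 𝔰𝔲(2)`, is `Σ_ν (⟨X,𝐩E_ν⟩/√2)·σ_(e,ν)`;
* `multiField_eq_sum_smul_frame` — the coordinate field of `(X_e·Q_e)_e` is `Σ_(e,ν) (⟨X_e,𝐩E_ν⟩/√2)·σ_(e,ν)`;
* `hasDerivAt_comp_coords_multiFlow` — `d/ds H(coords((e^(sX_e)·V_e)_e)) = DH(coords V_s)[coords-field of (X_e (V_s)_e)_e]`;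
* ★★★ `oscillation_le_of_carre_le` — for `C¹` `G` with `Γ^A(G) ≤ σ²` on the group: `|G(coords V') − G(coords V)| ≤ π·√#E·σ` for all `V, V'`.
THEOREMS ONLY, no definition, no sorry; all [folklore] (sub-Riemannian length of `SU(2)^E` along left-invariant frames).  HONEST FRAMING: this is
fixed-lattice geometry; it says nothing about Yang–Mills dynamics by itself, nothing is `K`-uniform, and the Yang–Mills mass gap is NOT proved.
-/

set_option autoImplicit false

noncomputable section

namespace Summit.QuantumFields.YangMills.Theorems.ColdStartUniversality

open Matrix Complex Finset
open scoped ComplexConjugate BigOperators Matrix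
open Literature.MathematicalPhysics.QuantumFieldTheory
open Literature.MathematicalPhysics.QuantumLattice (fundamentalRep fundamentalLatticeRep continuous_fundamentalRep fundamentalRep_apply)

variable {L : ℕ} [NeZero L]

/-! ## §1. The coordinate field of `δ_e(X·Q_e)` along the noise frame -/

omit [NeZero L] in
/-- **Frame decomposition of a block field**: for `X ∈ 𝔰𝔲(2)`, a link `e` and a coordinate vector `y`, the coordinate field of
`δ_e(X·rebuild(y)_e)` equals `Σ_ν (⟨X, 𝐩E_ν⟩/√2)·σ_(e,ν)(y)` (Parseval `Σ_ν ⟨X,𝐩E_ν⟩ 𝐩E_ν = X` on `𝔰𝔲(2)`). [folklore] -/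
theorem frameField_decomposition (e : Edge 3 L) {X : Matrix (Fin (fundamentalLatticeRep 2).N) (Fin (fundamentalLatticeRep 2).N) ℂ}
    (hX : X ∈ (fundamentalLatticeRep 2).lieAlg) (y : (Edge 3 L × Fin (fundamentalLatticeRep 2).N × Fin (fundamentalLatticeRep 2).N × Bool → ℝ)) :
    (fun q : Edge 3 L × Fin (fundamentalLatticeRep 2).N × Fin (fundamentalLatticeRep 2).N × Bool => if e = q.1 then (fun z : ℂ => if q.2.2.2 then z.im else z.re) ((X * (fun (ee : Edge 3 L) => Matrix.of fun (i j : Fin (fundamentalLatticeRep 2).N) => ((y (ee, i, j, false) : ℝ) : ℂ) + ((y (ee, i, j, true) : ℝ) : ℂ) * Complex.I) q.1) q.2.1 q.2.2.1) else 0) =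
      ∑ ν : NoiseIdx (fundamentalLatticeRep 2).N, (hsForm (fundamentalLatticeRep 2).N X ((fundamentalLatticeRep 2).lieProj (noiseDir ν)) / Real.sqrt 2) • (fun q : Edge 3 L × Fin (fundamentalLatticeRep 2).N × Fin (fundamentalLatticeRep 2).N × Bool => if (e, ν).1 = q.1 then (fun z : ℂ => if q.2.2.2 then z.im else z.re) (((Real.sqrt 2 : ℂ) • ((fundamentalLatticeRep 2).lieProj (noiseDir (e, ν).2) * (fun (ee : Edge 3 L) => Matrix.of fun (i j : Fin (fundamentalLatticeRep 2).N) => ((y (ee, i, j, false) : ℝ) : ℂ) + ((y (ee, i, j, true) : ℝ) : ℂ) * Complex.I) q.1)) q.2.1 q.2.2.1) else 0) := by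
  classical
  have hP := sum_hsForm_smul_lieProj_of_mem hX
  have hsqrt : Real.sqrt 2 ≠ 0 := by positivity
  have hscal : ∀ a r : ℝ, a / Real.sqrt 2 * (Real.sqrt 2 * r) = a * r := fun a r => by
    rw [← mul_assoc, div_mul_cancel₀ _ hsqrt]
  -- `X·R = Σ_ν ⟨X,P_ν⟩ P_ν·R`, entrywise
  have hXR : ∀ R : Matrix (Fin (fundamentalLatticeRep 2).N) (Fin (fundamentalLatticeRep 2).N) ℂ, X * R = ∑ ν : NoiseIdx (fundamentalLatticeRep 2).N,
      hsForm (fundamentalLatticeRep 2).N X ((fundamentalLatticeRep 2).lieProj (noiseDir ν)) • (((fundamentalLatticeRep 2).lieProj (noiseDir ν)) * R) := by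
    intro R
    conv_lhs => rw [← hP]
    rw [Finset.sum_mul]
    exact Finset.sum_congr rfl fun ν _ => smul_mul_assoc _ _ _
  have hentry : ∀ (R : Matrix (Fin (fundamentalLatticeRep 2).N) (Fin (fundamentalLatticeRep 2).N) ℂ) (i j : Fin (fundamentalLatticeRep 2).N), (X * R) i j = ∑ ν : NoiseIdx (fundamentalLatticeRep 2).N,
      (((hsForm (fundamentalLatticeRep 2).N X ((fundamentalLatticeRep 2).lieProj (noiseDir ν)) : ℝ) : ℂ)) * ((((fundamentalLatticeRep 2).lieProj (noiseDir ν)) * R) i j) := by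
    intro R i j
    rw [hXR R, Matrix.sum_apply]
    refine Finset.sum_congr rfl fun ν _ => ?_
    rw [Matrix.smul_apply, Complex.real_smul]
  have hre : ∀ (R : Matrix (Fin (fundamentalLatticeRep 2).N) (Fin (fundamentalLatticeRep 2).N) ℂ) (i j : Fin (fundamentalLatticeRep 2).N), ((X * R) i j).re = ∑ ν : NoiseIdx (fundamentalLatticeRep 2).N,
      hsForm (fundamentalLatticeRep 2).N X ((fundamentalLatticeRep 2).lieProj (noiseDir ν)) / Real.sqrt 2 * (((Real.sqrt 2 : ℂ) • (((fundamentalLatticeRep 2).lieProj (noiseDir ν)) * R)) i j).re := by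
    intro R i j
    rw [hentry, Complex.re_sum]
    refine Finset.sum_congr rfl fun ν _ => ?_
    rw [Matrix.smul_apply, smul_eq_mul, Complex.mul_re, Complex.mul_re]
    simp only [Complex.ofReal_re, Complex.ofReal_im, zero_mul, sub_zero]
    rw [hscal]
  have him : ∀ (R : Matrix (Fin (fundamentalLatticeRep 2).N) (Fin (fundamentalLatticeRep 2).N) ℂ) (i j : Fin (fundamentalLatticeRep 2).N), ((X * R) i j).im = ∑ ν : NoiseIdx (fundamentalLatticeRep 2).N,
      hsForm (fundamentalLatticeRep 2).N X ((fundamentalLatticeRep 2).lieProj (noiseDir ν)) / Real.sqrt 2 * (((Real.sqrt 2 : ℂ) • (((fundamentalLatticeRep 2).lieProj (noiseDir ν)) * R)) i j).im := by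
    intro R i j
    rw [hentry, Complex.im_sum]
    refine Finset.sum_congr rfl fun ν _ => ?_
    rw [Matrix.smul_apply, smul_eq_mul, Complex.mul_im, Complex.mul_im]
    simp only [Complex.ofReal_re, Complex.ofReal_im, zero_mul, add_zero]
    rw [hscal]
  funext q
  obtain ⟨e', i, j, b⟩ := q
  by_cases h : e = e'
  · subst h
    cases b
    · simp only [Finset.sum_apply, Pi.smul_apply, smul_eq_mul, if_true, Bool.false_eq_true, if_false]
      exact hre _ _ _
    · simp only [Finset.sum_apply, Pi.smul_apply, smul_eq_mul, if_true]
      exact him _ _ _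
  · simp only [Finset.sum_apply, Pi.smul_apply, smul_eq_mul, h, if_false, mul_zero, Finset.sum_const_zero]

/-- **Frame decomposition of the simultaneous field**: for `X_e ∈ 𝔰𝔲(2)` (`e` ranging over all links), the coordinate field of
`(X_e·rebuild(y)_e)_e` equals `Σ_(e,ν) (⟨X_e, 𝐩E_ν⟩/√2)·σ_(e,ν)(y)`. [folklore] -/
theorem multiField_eq_sum_smul_frame (X : Edge 3 L → Matrix (Fin (fundamentalLatticeRep 2).N) (Fin (fundamentalLatticeRep 2).N) ℂ)
    (hX : ∀ e, X e ∈ (fundamentalLatticeRep 2).lieAlg) (y : (Edge 3 L × Fin (fundamentalLatticeRep 2).N × Fin (fundamentalLatticeRep 2).N × Bool → ℝ)) :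
    (fun q : Edge 3 L × Fin (fundamentalLatticeRep 2).N × Fin (fundamentalLatticeRep 2).N × Bool => (fun z : ℂ => if q.2.2.2 then z.im else z.re) ((X q.1 * (fun (ee : Edge 3 L) => Matrix.of fun (i j : Fin (fundamentalLatticeRep 2).N) => ((y (ee, i, j, false) : ℝ) : ℂ) + ((y (ee, i, j, true) : ℝ) : ℂ) * Complex.I) q.1) q.2.1 q.2.2.1)) =
      ∑ n : Edge 3 L × NoiseIdx (fundamentalLatticeRep 2).N, (hsForm (fundamentalLatticeRep 2).N (X n.1) ((fundamentalLatticeRep 2).lieProj (noiseDir n.2)) / Real.sqrt 2) • (fun q : Edge 3 L × Fin (fundamentalLatticeRep 2).N × Fin (fundamentalLatticeRep 2).N × Bool => if n.1 = q.1 then (fun z : ℂ => if q.2.2.2 then z.im else z.re) (((Real.sqrt 2 : ℂ) • ((fundamentalLatticeRep 2).lieProj (noiseDir n.2) * (fun (ee : Edge 3 L) => Matrix.of fun (i j : Fin (fundamentalLatticeRep 2).N) => ((y (ee, i, j, false) : ℝ) : ℂ) + ((y (ee, i, j, true) : ℝ) : ℂ) * Complex.I) q.1)) q.2.1 q.2.2.1)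 else 0) := by
  classical
  have hblocks : (fun q : Edge 3 L × Fin (fundamentalLatticeRep 2).N × Fin (fundamentalLatticeRep 2).N × Bool => (fun z : ℂ => if q.2.2.2 then z.im else z.re) ((X q.1 * (fun (ee : Edge 3 L) => Matrix.of fun (i j : Fin (fundamentalLatticeRep 2).N) => ((y (ee, i, j, false) : ℝ) : ℂ) + ((y (ee, i, j, true) : ℝ) : ℂ) * Complex.I) q.1) q.2.1 q.2.2.1)) =
      ∑ e : Edge 3 L, (fun q : Edge 3 L × Fin (fundamentalLatticeRep 2).N × Fin (fundamentalLatticeRep 2).N × Bool => if e = q.1 then (fun z : ℂ => if q.2.2.2 then z.im else z.re) ((X e * (fun (ee : Edge 3 L) => Matrix.of fun (i j : Fin (fundamentalLatticeRep 2).N) => ((y (ee, i, j, false) : ℝ) : ℂ) + ((y (ee, i, j, true) : ℝ) : ℂ) * Complex.I) q.1) q.2.1 q.2.2.1) else 0) := by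
    funext q
    rw [Finset.sum_apply, Finset.sum_ite_eq', if_pos (Finset.mem_univ _)]
  rw [hblocks]
  symm
  rw [Fintype.sum_prod_type]
  exact Finset.sum_congr rfl fun e _ => (frameField_decomposition (L := L) e (hX e) y).symm

/-! ## §2. Derivative of a cylinder function along the simultaneous left flow -/

section Flow

open scoped Matrix.Norms.Operator

/-- **Derivative along the simultaneous one-parameter flow** `s ↦ (e^(sX_e)·V_e)_e`, `X_e ∈ 𝔰𝔲(2)`: for differentiable `H`,
`d/ds H(coords V_s) = DH(coords V_s)[coords-field of (X_e·(V_s)_e)_e]`. [folklore] -/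
theorem hasDerivAt_comp_coords_multiFlow (X : Edge 3 L → Matrix (Fin (fundamentalLatticeRep 2).N) (Fin (fundamentalLatticeRep 2).N) ℂ)
    (hX : ∀ e, (X e)ᴴ = -(X e)) (hX0 : ∀ e, (X e).trace = 0)
    (V : (GaugeConfig 3 L (Matrix.specialUnitaryGroup (Fin 2) ℂ))) {H : (Edge 3 L × Fin (fundamentalLatticeRep 2).N × Fin (fundamentalLatticeRep 2).N × Bool → ℝ) → ℝ} (hH : Differentiable ℝ H) (s : ℝ) :
    HasDerivAt (fun s : ℝ => H ((fun (V : GaugeConfig 3 L (Matrix.specialUnitaryGroup (Fin 2) ℂ)) (q : Edge 3 L × Fin (fundamentalLatticeRep 2).N × Fin (fundamentalLatticeRep 2).N × Bool) => (fun z : ℂ => if q.2.2.2 then z.im else z.re) ((fundamentalRep (Fin 2) (V q.1) : Matrix (Fin 2) (Fin 2) ℂ) q.2.1 q.2.2.1)) ((fun e => SUNBakryEmery.expSU (N := 2) (Y := Matrix.of fun i j : Fin 2 => X e i j) (hX e) (hX0 e) s) * V)))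
      (fderiv ℝ H ((fun (V : GaugeConfig 3 L (Matrix.specialUnitaryGroup (Fin 2) ℂ)) (q : Edge 3 L × Fin (fundamentalLatticeRep 2).N × Fin (fundamentalLatticeRep 2).N × Bool) => (fun z : ℂ => if q.2.2.2 then z.im else z.re) ((fundamentalRep (Fin 2) (V q.1) : Matrix (Fin 2) (Fin 2) ℂ) q.2.1 q.2.2.1)) ((fun e => SUNBakryEmery.expSU (N := 2) (Y := Matrix.of fun i j : Fin 2 => X e i j) (hX e) (hX0 e) s) * V)) (fun q : Edge 3 L × Fin (fundamentalLatticeRep 2).N × Fin (fundamentalLatticeRep 2).N × Bool => (fun z : ℂ => if q.2.2.2 then z.im else z.re) ((X q.1 * (fun (ee : Edge 3 L) => Matrix.of fun (i j : Fin (fundamentalLatticeRep 2).N) => (((fun (V : GaugeConfig 3 L (Matrix.specialUnitaryGroup (Fin 2) ℂ)) (q : Edge 3 L × Fin (fundamentalLatticeRep 2).N × Fin (fundamentalLatticeRep 2).N × Bool) => (fun z : ℂ => if q.2.2.2 then z.im else z.re) ((fundamentalRep (Fin 2) (V q.1) : Matrix (Fin 2) (Fin 2) ℂ) q.2.1 q.2.2.1))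 ((fun e => SUNBakryEmery.expSU (N := 2) (Y := Matrix.of fun i j : Fin 2 => X e i j) (hX e) (hX0 e) s) * V) (ee, i, j, false) : ℝ) : ℂ) + (((fun (V : GaugeConfig 3 L (Matrix.specialUnitaryGroup (Fin 2) ℂ)) (q : Edge 3 L × Fin (fundamentalLatticeRep 2).N × Fin (fundamentalLatticeRep 2).N × Bool) => (fun z : ℂ => if q.2.2.2 then z.im else z.re) ((fundamentalRep (Fin 2) (V q.1) : Matrix (Fin 2) (Fin 2) ℂ) q.2.1 q.2.2.1)) ((fun e => SUNBakryEmery.expSU (N := 2) (Y := Matrix.of fun i j : Fin 2 => X e i j) (hX e) (hX0 e) s) * V) (ee, i, j, true) : ℝ) : ℂ) * Complex.I) q.1) q.2.1 q.2.2.1))) s := by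
  classical
  set co : (GaugeConfig 3 L (Matrix.specialUnitaryGroup (Fin 2) ℂ)) → (Edge 3 L × Fin (fundamentalLatticeRep 2).N × Fin (fundamentalLatticeRep 2).N × Bool → ℝ) := (fun (V : GaugeConfig 3 L (Matrix.specialUnitaryGroup (Fin 2) ℂ)) (q : Edge 3 L × Fin (fundamentalLatticeRep 2).N × Fin (fundamentalLatticeRep 2).N × Bool) => (fun z : ℂ => if q.2.2.2 then z.im else z.re) ((fundamentalRep (Fin 2) (V q.1) : Matrix (Fin 2) (Fin 2) ℂ) q.2.1 q.2.2.1)) with hco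
  set u : ℝ → (GaugeConfig 3 L (Matrix.specialUnitaryGroup (Fin 2) ℂ)) := fun s => (fun e => SUNBakryEmery.expSU (N := 2) (Y := Matrix.of fun i j : Fin 2 => X e i j) (hX e) (hX0 e) s) with hu
  set X2 : Edge 3 L → Matrix (Fin 2) (Fin 2) ℂ := fun e => Matrix.of fun i j : Fin 2 => X e i j with hX2
  set M : Edge 3 L → Matrix (Fin 2) (Fin 2) ℂ := fun e => (fundamentalRep (Fin 2) (V e) : Matrix (Fin 2) (Fin 2) ℂ) with hM
  -- the linear read-out `N ↦ (re/im (N_e)_ij)`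
  set Lf : (Edge 3 L → Matrix (Fin 2) (Fin 2) ℂ) → (Edge 3 L × Fin (fundamentalLatticeRep 2).N × Fin (fundamentalLatticeRep 2).N × Bool → ℝ) := fun N q => (fun z : ℂ => if q.2.2.2 then z.im else z.re) (N q.1 q.2.1 q.2.2.1) with hLf
  have hLadd : ∀ N N', Lf (N + N') = Lf N + Lf N' := by
    intro N N'; funext q; obtain ⟨e', i, j, b⟩ := q
    rw [Pi.add_apply]
    cases b <;> simp [hLf, Matrix.add_apply]
  have hLsmul : ∀ (a : ℝ) N, Lf (a • N) = a • Lf N := by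
    intro a N; funext q; obtain ⟨e', i, j, b⟩ := q
    rw [Pi.smul_apply]
    cases b <;> simp [hLf, Matrix.smul_apply]
  let Ll : (Edge 3 L → Matrix (Fin 2) (Fin 2) ℂ) →ₗ[ℝ] (Edge 3 L × Fin (fundamentalLatticeRep 2).N × Fin (fundamentalLatticeRep 2).N × Bool → ℝ) := { toFun := Lf, map_add' := hLadd, map_smul' := hLsmul }
  let Lc : (Edge 3 L → Matrix (Fin 2) (Fin 2) ℂ) →L[ℝ] (Edge 3 L × Fin (fundamentalLatticeRep 2).N × Fin (fundamentalLatticeRep 2).N × Bool → ℝ) := LinearMap.toContinuousLinearMap Ll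
  have hLc : ∀ N, Lc N = Lf N := fun N => rfl
  -- the curve in coordinates
  have hcurve : ∀ s, co (u s * V) = Lc (fun e => NormedSpace.exp (s • X2 e) * M e) := by
    intro s
    funext q
    rw [hLc]
    simp only [hco, hLf, hu, hM, hX2, Pi.mul_apply]
    rw [map_mul, fundamentalRep_apply, SUNBakryEmery.coe_expSU]
  have hmat : HasDerivAt (fun s : ℝ => fun e => NormedSpace.exp (s • X2 e) * M e) (fun e => X2 e * NormedSpace.exp (s • X2 e) * M e) s :=
    hasDerivAt_pi.2 fun e => (hasDerivAt_exp_smul_const' (𝕂 := ℝ) (X2 e) s).mul_const (M e)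
  have hLcurve : HasDerivAt (fun s : ℝ => Lc (fun e => NormedSpace.exp (s • X2 e) * M e)) (Lc (fun e => X2 e * NormedSpace.exp (s • X2 e) * M e)) s :=
    Lc.hasFDerivAt.comp_hasDerivAt s hmat
  have hc' : HasDerivAt (fun s : ℝ => co (u s * V)) (Lc (fun e => X2 e * NormedSpace.exp (s • X2 e) * M e)) s := by
    have heq : (fun s : ℝ => co (u s * V)) = fun s => Lc (fun e => NormedSpace.exp (s • X2 e) * M e) := funext hcurve
    rw [heq]; exact hLcurve
  have hcomp := (hH (co (u s * V))).hasFDerivAt.comp_hasDerivAt s hc'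
  -- identify the direction with the field at the current point
  have hdir : Lc (fun e => X2 e * NormedSpace.exp (s • X2 e) * M e) = (fun q : Edge 3 L × Fin (fundamentalLatticeRep 2).N × Fin (fundamentalLatticeRep 2).N × Bool => (fun z : ℂ => if q.2.2.2 then z.im else z.re) ((X q.1 * (fun (ee : Edge 3 L) => Matrix.of fun (i j : Fin (fundamentalLatticeRep 2).N) => (((co (u s * V)) (ee, i, j, false) : ℝ) : ℂ) + (((co (u s * V)) (ee, i, j, true) : ℝ) : ℂ) * Complex.I) q.1) q.2.1 q.2.2.1)) := by
    rw [hLc, rebuild_coords_of]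
    funext q
    simp only [hLf]
    have hq : (u s * V) q.1 = (SUNBakryEmery.expSU (N := 2) (Y := Matrix.of fun i j : Fin 2 => X q.1 i j) (hX q.1) (hX0 q.1) s) * V q.1 := by
      simp only [hu, Pi.mul_apply]
    have hm : X2 q.1 * NormedSpace.exp (s • X2 q.1) * M q.1 =
        X q.1 * Matrix.of fun i j : Fin (fundamentalLatticeRep 2).N => (fundamentalRep (Fin 2) ((u s * V) q.1) : Matrix (Fin 2) (Fin 2) ℂ) i j := by
      rw [hq, map_mul, fundamentalRep_apply, SUNBakryEmery.coe_expSU, Matrix.mul_assoc]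
      rfl
    rw [hm]
  exact hcomp.congr_deriv (by rw [hdir])

end Flow

/-! ## §3. The oscillation bound -/

/-- ★★★ **Oscillation–carré du champ lemma on `SU(2)^E`**: for a `C¹` function `G` of the real link coordinates with `Γ^A(G) ≤ σ²` on the
group (`Γ^A` the carré du champ of the `SU(2)` lattice Langevin generator in ambient coordinates), `|G(coords V') − G(coords V)| ≤ π·√#E·σ`
for all configurations `V, V'` (`#E` = number of links): every `V'` is reached from `V` by the simultaneous flow `(e^(sX_e) V_e)_e`, `s ∈ [0,1]`,
with `Σ_e ⟨X_e,X_e⟩ ≤ 2π²·#E`, along which `|d/ds G| ≤ √(Σ_n c_n²)·√Γ^A(G) ≤ π√#E·σ`.  [folklore] -/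
theorem oscillation_le_of_carre_le (L : ℕ) [NeZero L] (β' : ℝ) {G : (Edge 3 L × Fin 2 × Fin 2 × Bool → ℝ) → ℝ} (hG : ContDiff ℝ 1 G) {σ : ℝ} (hσ : 0 ≤ σ) :
    let coords : GaugeConfig 3 L (Matrix.specialUnitaryGroup (Fin 2) ℂ) → (Edge 3 L × Fin 2 × Fin 2 × Bool → ℝ) :=
      fun V q => (fun z : ℂ => if q.2.2.2 then z.im else z.re)
        ((fundamentalRep (Fin 2) (V q.1) : Matrix (Fin 2) (Fin 2) ℂ) q.2.1 q.2.2.1)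
    let A : GaugeConfig 3 L (Matrix.specialUnitaryGroup (Fin 2) ℂ) → (Edge 3 L × Fin 2 × Fin 2 × Bool) →
        (Edge 3 L × Fin 2 × Fin 2 × Bool) → ℝ := fun V i j =>
      ∑ n : Edge 3 L × NoiseIdx 2,
        (if n.1 = i.1 then (fun z : ℂ => if i.2.2.2 then z.im else z.re)
          ((latticeLangevinDynamics (fundamentalLatticeRep 2) β').noise
            (matrixConfig (fundamentalRep (Fin 2)) V) i.1 n.2 i.2.1 i.2.2.1) else 0) *
        (if n.1 = j.1 then (fun z : ℂ => if j.2.2.2 then z.im else z.re)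
          ((latticeLangevinDynamics (fundamentalLatticeRep 2) β').noise
            (matrixConfig (fundamentalRep (Fin 2)) V) j.1 n.2 j.2.1 j.2.2.1) else 0)
    (∀ x, (∑ i : Edge 3 L × Fin 2 × Fin 2 × Bool, ∑ j : Edge 3 L × Fin 2 × Fin 2 × Bool, fderiv ℝ G (coords x) (Pi.single i 1) * fderiv ℝ G (coords x) (Pi.single j 1) * A x i j) ≤ σ ^ 2) → ∀ V V' : (GaugeConfig 3 L (Matrix.specialUnitaryGroup (Fin 2) ℂ)),
      |G (coords V') - G (coords V)| ≤ Real.pi * Real.sqrt (Fintype.card (Edge 3 L)) * σ := by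
  intro coords A hΓ V V'
  classical
  have hGd : Differentiable ℝ G := hG.differentiable (by norm_num)
  -- norm-controlled logarithms of `V'_e V_e⁻¹`
  have hlog : ∀ e : Edge 3 L, ∃ X : Matrix (Fin (fundamentalLatticeRep 2).N) (Fin (fundamentalLatticeRep 2).N) ℂ, Xᴴ = -X ∧ X.trace = 0 ∧
      NormedSpace.exp X = ((V' e * (V e)⁻¹ : Matrix.specialUnitaryGroup (Fin 2) ℂ) : Matrix (Fin 2) (Fin 2) ℂ) ∧
      hsForm (fundamentalLatticeRep 2).N X X ≤ 2 * Real.pi ^ 2 := fun e => exists_su2_generator_norm_le (V' e * (V e)⁻¹)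
  choose X hXskew hXtr hXexp hXnorm using hlog
  set u : ℝ → (GaugeConfig 3 L (Matrix.specialUnitaryGroup (Fin 2) ℂ)) := fun s => (fun e => SUNBakryEmery.expSU (N := 2) (Y := Matrix.of fun i j : Fin 2 => X e i j) (hXskew e) (hXtr e) s) with hu
  have hu0 : u 0 * V = V := by
    funext e
    have h1 : (SUNBakryEmery.expSU (N := 2) (Y := Matrix.of fun i j : Fin 2 => X e i j) (hXskew e) (hXtr e) (0 : ℝ)) = 1 :=
      Subtype.ext (by rw [SUNBakryEmery.coe_expSU, zero_smul, NormedSpace.exp_zero]; rfl)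
    simp only [hu, Pi.mul_apply, h1, one_mul]
  have hu1 : u 1 * V = V' := by
    funext e
    have h1 : (SUNBakryEmery.expSU (N := 2) (Y := Matrix.of fun i j : Fin 2 => X e i j) (hXskew e) (hXtr e) (1 : ℝ)) = V' e * (V e)⁻¹ := by
      apply Subtype.ext
      rw [SUNBakryEmery.coe_expSU, one_smul]
      exact hXexp e
    simp only [hu, Pi.mul_apply, h1, inv_mul_cancel_right]
  -- the coefficients `c_(e,ν) = ⟨X_e, 𝐩E_ν⟩/√2`, `Σ_n c_n² = ½ Σ_e ⟨X_e,X_e⟩ ≤ π²·#E`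
  set c : Edge 3 L × NoiseIdx (fundamentalLatticeRep 2).N → ℝ := fun n =>
    hsForm (fundamentalLatticeRep 2).N (X n.1) ((fundamentalLatticeRep 2).lieProj (noiseDir n.2)) / Real.sqrt 2 with hc
  have hXmem : ∀ e, X e ∈ (fundamentalLatticeRep 2).lieAlg := fun e =>
    mem_lieAlg_two_of_star_eq_neg (by rw [Matrix.star_eq_conjTranspose]; exact hXskew e) (hXtr e)
  have hcsq : ∑ n : Edge 3 L × NoiseIdx (fundamentalLatticeRep 2).N, c n ^ 2 ≤ Real.pi ^ 2 * Fintype.card (Edge 3 L) := by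
    have h1 : ∀ e : Edge 3 L, ∑ ν : NoiseIdx (fundamentalLatticeRep 2).N, c (e, ν) ^ 2 =
        hsForm (fundamentalLatticeRep 2).N (X e) (X e) / 2 := by
      intro e
      have hP := sum_hsForm_lieProj_noiseDir_sq (r := fundamentalLatticeRep 2) (X e)
      rw [(fundamentalLatticeRep 2).lieProj_of_mem (hXmem e)] at hP
      rw [← hP, Finset.sum_div]
      refine Finset.sum_congr rfl fun ν _ => ?_
      simp only [hc, div_pow, Real.sq_sqrt (show (0:ℝ) ≤ 2 by norm_num)]
    have h2 : ∑ n : Edge 3 L × NoiseIdx (fundamentalLatticeRep 2).N, c n ^ 2 =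
        ∑ e : Edge 3 L, ∑ ν : NoiseIdx (fundamentalLatticeRep 2).N, c (e, ν) ^ 2 := by
      rw [Fintype.sum_prod_type]
    rw [h2]
    calc ∑ e : Edge 3 L, ∑ ν : NoiseIdx (fundamentalLatticeRep 2).N, c (e, ν) ^ 2
        = ∑ e : Edge 3 L, hsForm (fundamentalLatticeRep 2).N (X e) (X e) / 2 := Finset.sum_congr rfl fun e _ => h1 e
      _ ≤ ∑ _e : Edge 3 L, Real.pi ^ 2 := Finset.sum_le_sum fun e _ => by have := hXnorm e; linarith
      _ = Real.pi ^ 2 * Fintype.card (Edge 3 L) := by rw [Finset.sum_const, Finset.card_univ, nsmul_eq_mul]; ring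
  -- the path `φ(s) = G(coords(u s · V))` and its derivative `Σ_n c_n W_nG(V_s)`
  set φ : ℝ → ℝ := fun s => G (coords (u s * V)) with hφ
  have hder : ∀ s, HasDerivAt φ (∑ n : Edge 3 L × NoiseIdx (fundamentalLatticeRep 2).N,
      c n * fderiv ℝ G ((fun (V : GaugeConfig 3 L (Matrix.specialUnitaryGroup (Fin 2) ℂ)) (q : Edge 3 L × Fin (fundamentalLatticeRep 2).N × Fin (fundamentalLatticeRep 2).N × Bool) => (fun z : ℂ => if q.2.2.2 then z.im else z.re) ((fundamentalRep (Fin 2) (V q.1) : Matrix (Fin 2) (Fin 2) ℂ) q.2.1 q.2.2.1)) ((fun e => SUNBakryEmery.expSU (N := 2) (Y := Matrix.of fun i j : Fin 2 => X e i j) (hXskew e) (hXtr e) s) * V)) (fun q : Edge 3 L × Fin (fundamentalLatticeRep 2).N × Fin (fundamentalLatticeRep 2).N × Bool => if n.1 = q.1 then (fun z : ℂ => if q.2.2.2 then z.im else z.re) (((Real.sqrt 2 : ℂ) • ((fundamentalLatticeRep 2).lieProj (noiseDir n.2) * (fun (ee : Edge 3 L) => Matrix.of fun (i j : Fin (fundamentalLatticeRep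 2).N) => (((fun (V : GaugeConfig 3 L (Matrix.specialUnitaryGroup (Fin 2) ℂ)) (q : Edge 3 L × Fin (fundamentalLatticeRep 2).N × Fin (fundamentalLatticeRep 2).N × Bool) => (fun z : ℂ => if q.2.2.2 then z.im else z.re) ((fundamentalRep (Fin 2) (V q.1) : Matrix (Fin 2) (Fin 2) ℂ) q.2.1 q.2.2.1)) ((fun e => SUNBakryEmery.expSU (N := 2) (Y := Matrix.of fun i j : Fin 2 => X e i j) (hXskew e) (hXtr e) s) * V) (ee, i, j, false) : ℝ) : ℂ) + (((fun (V : GaugeConfig 3 L (Matrix.specialUnitaryGroup (Fin 2) ℂ)) (q : Edge 3 L × Fin (fundamentalLatticeRep 2).N × Fin (fundamentalLatticeRep 2).N × Bool) => (fun z : ℂ => if q.2.2.2 then z.im else z.re) ((fundamentalRep (Fin 2) (V q.1) : Matrix (Fin 2) (Fin 2) ℂ) q.2.1 q.2.2.1)) ((fun e => SUNBakryEmery.expSU (N := 2) (Y := Matrix.of fun i j : Fin 2 => X e i j) (hXskew e) (hXtr e) s) * V) (ee, i, j, true) : ℝ) : ℂ) * Complex.I) q.1)) q.2.1 q.2.2.1)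 else 0)) s := by
    intro s
    have h := hasDerivAt_comp_coords_multiFlow (L := L) X hXskew hXtr V hGd s
    have hfield : (fun q : Edge 3 L × Fin (fundamentalLatticeRep 2).N × Fin (fundamentalLatticeRep 2).N × Bool => (fun z : ℂ => if q.2.2.2 then z.im else z.re) ((X q.1 * (fun (ee : Edge 3 L) => Matrix.of fun (i j : Fin (fundamentalLatticeRep 2).N) => (((fun (V : GaugeConfig 3 L (Matrix.specialUnitaryGroup (Fin 2) ℂ)) (q : Edge 3 L × Fin (fundamentalLatticeRep 2).N × Fin (fundamentalLatticeRep 2).N × Bool) => (fun z : ℂ => if q.2.2.2 then z.im else z.re) ((fundamentalRep (Fin 2) (V q.1) : Matrix (Fin 2) (Fin 2) ℂ) q.2.1 q.2.2.1)) ((fun e => SUNBakryEmery.expSU (N := 2) (Y := Matrix.of fun i j : Fin 2 => X e i j) (hXskew e) (hXtr e) s) * V) (ee, i, j, false) : ℝ) : ℂ) + (((fun (V : GaugeConfig 3 L (Matrix.specialUnitaryGroup (Fin 2) ℂ)) (q : Edge 3 L × Fin (fundamentalLatticeRep 2).N × Fin (fundamentalLatticeRep 2).N × Bool) => (fun z :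 ℂ => if q.2.2.2 then z.im else z.re) ((fundamentalRep (Fin 2) (V q.1) : Matrix (Fin 2) (Fin 2) ℂ) q.2.1 q.2.2.1)) ((fun e => SUNBakryEmery.expSU (N := 2) (Y := Matrix.of fun i j : Fin 2 => X e i j) (hXskew e) (hXtr e) s) * V) (ee, i, j, true) : ℝ) : ℂ) * Complex.I) q.1) q.2.1 q.2.2.1)) =
        ∑ n : Edge 3 L × NoiseIdx (fundamentalLatticeRep 2).N, c n • (fun q : Edge 3 L × Fin (fundamentalLatticeRep 2).N × Fin (fundamentalLatticeRep 2).N × Bool => if n.1 = q.1 then (fun z : ℂ => if q.2.2.2 then z.im else z.re) (((Real.sqrt 2 : ℂ) • ((fundamentalLatticeRep 2).lieProj (noiseDir n.2) * (fun (ee : Edge 3 L) => Matrix.of fun (i j : Fin (fundamentalLatticeRep 2).N) => (((fun (V : GaugeConfig 3 L (Matrix.specialUnitaryGroup (Fin 2) ℂ)) (q : Edge 3 L × Fin (fundamentalLatticeRep 2).N × Fin (fundamentalLatticeRep 2).N × Bool) => (fun z : ℂ => if q.2.2.2 then z.im else z.re) ((fundamentalRep (Fin 2) (V q.1) : Matrix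 (Fin 2) (Fin 2) ℂ) q.2.1 q.2.2.1)) ((fun e => SUNBakryEmery.expSU (N := 2) (Y := Matrix.of fun i j : Fin 2 => X e i j) (hXskew e) (hXtr e) s) * V) (ee, i, j, false) : ℝ) : ℂ) + (((fun (V : GaugeConfig 3 L (Matrix.specialUnitaryGroup (Fin 2) ℂ)) (q : Edge 3 L × Fin (fundamentalLatticeRep 2).N × Fin (fundamentalLatticeRep 2).N × Bool) => (fun z : ℂ => if q.2.2.2 then z.im else z.re) ((fundamentalRep (Fin 2) (V q.1) : Matrix (Fin 2) (Fin 2) ℂ) q.2.1 q.2.2.1)) ((fun e => SUNBakryEmery.expSU (N := 2) (Y := Matrix.of fun i j : Fin 2 => X e i j) (hXskew e) (hXtr e) s) * V) (ee, i, j, true) : ℝ) : ℂ) * Complex.I) q.1)) q.2.1 q.2.2.1) else 0) :=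
      multiField_eq_sum_smul_frame (L := L) X hXmem ((fun (V : GaugeConfig 3 L (Matrix.specialUnitaryGroup (Fin 2) ℂ)) (q : Edge 3 L × Fin (fundamentalLatticeRep 2).N × Fin (fundamentalLatticeRep 2).N × Bool) => (fun z : ℂ => if q.2.2.2 then z.im else z.re) ((fundamentalRep (Fin 2) (V q.1) : Matrix (Fin 2) (Fin 2) ℂ) q.2.1 q.2.2.1)) ((fun e => SUNBakryEmery.expSU (N := 2) (Y := Matrix.of fun i j : Fin 2 => X e i j) (hXskew e) (hXtr e) s) * V))
    rw [hfield, map_sum] at h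
    refine h.congr_deriv (Finset.sum_congr rfl fun n _ => ?_)
    rw [map_smul, smul_eq_mul]
    rfl
  -- bound on the derivative: Cauchy–Schwarz and the carré du champ dictionary `Σ_n (W_nG)² = Γ^A(G)`
  have hbound : ∀ s, |∑ n : Edge 3 L × NoiseIdx (fundamentalLatticeRep 2).N,
      c n * fderiv ℝ G (coords (u s * V)) (fun q : Edge 3 L × Fin (fundamentalLatticeRep 2).N × Fin (fundamentalLatticeRep 2).N × Bool => if n.1 = q.1 then (fun z : ℂ => if q.2.2.2 then z.im else z.re) (((Real.sqrt 2 : ℂ) • ((fundamentalLatticeRep 2).lieProj (noiseDir n.2) * (fun (ee : Edge 3 L) => Matrix.of fun (i j : Fin (fundamentalLatticeRep 2).N) => (((coords (u s * V)) (ee, i, j, false) : ℝ) : ℂ) + (((coords (u s * V)) (ee, i, j, true) : ℝ) : ℂ) * Complex.I) q.1)) q.2.1 q.2.2.1) else 0)| ≤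
      Real.pi * Real.sqrt (Fintype.card (Edge 3 L)) * σ := by
    intro s
    set w : Edge 3 L × NoiseIdx (fundamentalLatticeRep 2).N → ℝ := fun n =>
      fderiv ℝ G (coords (u s * V)) (fun q : Edge 3 L × Fin (fundamentalLatticeRep 2).N × Fin (fundamentalLatticeRep 2).N × Bool => if n.1 = q.1 then (fun z : ℂ => if q.2.2.2 then z.im else z.re) (((Real.sqrt 2 : ℂ) • ((fundamentalLatticeRep 2).lieProj (noiseDir n.2) * (fun (ee : Edge 3 L) => Matrix.of fun (i j : Fin (fundamentalLatticeRep 2).N) => (((coords (u s * V)) (ee, i, j, false) : ℝ) : ℂ) + (((coords (u s * V)) (ee, i, j, true) : ℝ) : ℂ) * Complex.I) q.1)) q.2.1 q.2.2.1) else 0) with hw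
    have hCS := Finset.sum_mul_sq_le_sq_mul_sq Finset.univ c w
    have hframe : (∑ i : Edge 3 L × Fin 2 × Fin 2 × Bool, ∑ j : Edge 3 L × Fin 2 × Fin 2 × Bool, fderiv ℝ G (coords (u s * V)) (Pi.single i 1) * fderiv ℝ G (coords (u s * V)) (Pi.single j 1) * A (u s * V) i j) = ∑ n : Edge 3 L × NoiseIdx (fundamentalLatticeRep 2).N,
        fderiv ℝ G (coords (u s * V)) (fun q : Edge 3 L × Fin (fundamentalLatticeRep 2).N × Fin (fundamentalLatticeRep 2).N × Bool => if n.1 = q.1 then (fun z : ℂ => if q.2.2.2 then z.im else z.re) (((Real.sqrt 2 : ℂ) • ((fundamentalLatticeRep 2).lieProj (noiseDir n.2) * (fun (ee : Edge 3 L) => Matrix.of fun (i j : Fin (fundamentalLatticeRep 2).N) => (((coords (u s * V)) (ee, i, j, false) : ℝ) : ℂ) + (((coords (u s * V)) (ee, i, j, true) : ℝ) : ℂ) * Complex.I) q.1)) q.2.1 q.2.2.1) else 0) * fderiv ℝ G (coords (u s * V)) (fun q : Edge 3 L × Fin (fundamentalLatticeRep 2).N × Fin (fundamentalLatticeRep 2).N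 × Bool => if n.1 = q.1 then (fun z : ℂ => if q.2.2.2 then z.im else z.re) (((Real.sqrt 2 : ℂ) • ((fundamentalLatticeRep 2).lieProj (noiseDir n.2) * (fun (ee : Edge 3 L) => Matrix.of fun (i j : Fin (fundamentalLatticeRep 2).N) => (((coords (u s * V)) (ee, i, j, false) : ℝ) : ℂ) + (((coords (u s * V)) (ee, i, j, true) : ℝ) : ℂ) * Complex.I) q.1)) q.2.1 q.2.2.1) else 0) :=
      carre_eq_sum_frameDeriv_mul L β' G G (u s * V)
    have hw_le : ∑ n : Edge 3 L × NoiseIdx (fundamentalLatticeRep 2).N, w n ^ 2 ≤ σ ^ 2 := by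
      have h := hΓ (u s * V)
      rw [hframe] at h
      simpa only [hw, sq] using h
    have h1 : (∑ n : Edge 3 L × NoiseIdx (fundamentalLatticeRep 2).N, c n * w n) ^ 2 ≤
        (Real.pi ^ 2 * Fintype.card (Edge 3 L)) * σ ^ 2 :=
      hCS.trans (mul_le_mul hcsq hw_le (Finset.sum_nonneg fun n _ => sq_nonneg _) (by positivity))
    have h2 := Real.abs_le_sqrt h1
    have h3 : Real.sqrt ((Real.pi ^ 2 * Fintype.card (Edge 3 L)) * σ ^ 2) = Real.pi * Real.sqrt (Fintype.card (Edge 3 L)) * σ := by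
      rw [Real.sqrt_mul (by positivity), Real.sqrt_mul (by positivity), Real.sqrt_sq Real.pi_pos.le, Real.sqrt_sq hσ]
    rw [h3] at h2
    exact h2
  -- mean value inequality on `[0, 1]`
  have hMV := norm_image_sub_le_of_norm_deriv_le_segment' (f := φ) (a := (0 : ℝ)) (b := 1)
    (C := Real.pi * Real.sqrt (Fintype.card (Edge 3 L)) * σ)
    (fun s _ => (hder s).hasDerivWithinAt) (fun s _ => by rw [Real.norm_eq_abs]; exact hbound s) 1
    (Set.right_mem_Icc.2 zero_le_one)
  rw [Real.norm_eq_abs, sub_zero, mul_one] at hMV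
  have hφ0 : φ 0 = G (coords V) := by simp only [hφ, hu0]
  have hφ1 : φ 1 = G (coords V') := by simp only [hφ, hu1]
  rw [hφ0, hφ1] at hMV
  exact hMV

end Summit.QuantumFields.YangMills.Theorems.ColdStartUniversality
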